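import Summits.ResolutionOfSingularities.ResolutionOfSingularities.Theorems.FrobeniusLadderFRationalResolutionGorensteinSector
import Summits.ResolutionOfSingularities.ResolutionOfSingularities.Theorems.FrobeniusLadderFRationalResolutionSocleCyclicOfOne
import Summits.ResolutionOfSingularities.ResolutionOfSingularities.Theorems.FrobeniusLadderFRationalResolutionFRationalCM
import HarnessLib

/-!
# Rung 3½ on the Gorenstein sector, Gorenstein form: F-rational + one irreducible parameter ideal ⇒ weakly F-regular

Support file for crux stmt-ResolutionOfSingularities-15317 (`FrobeniusLadder.FRationalResolution`),
line `Sketch`, continuation seat c3, wave 2: assembly of `stub_socle_cyclic_of_one` (p140016, the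
type of a Cohen–Macaulay local ring is an invariant: cyclicity of the socle of `R/q` does not depend
on the parameter ideal `q`) with the sector theorem `weaklyFRegular_of_fRational_of_socle_cyclic`
(p139765) and "F-rational ⇒ Cohen–Macaulay" (Hochster–Huneke 1994 Thm. 4.2 (c), proved in the tree
by colon capturing: `isWeaklyRegular_of_fRational_clause_quotient`, c1).

* `weaklyFRegular_of_fRational_gorenstein` — Hochster–Huneke's theorem "F-rational Gorenstein local
  rings are weakly F-regular" in the tree's vocabulary (Gorenstein = Cohen–Macaulay of type 1, the
  Cohen–Macaulayness being free): for a regular local ring `S` of prime characteristic `p` and a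
  prime `Q`, if every parameter ideal of `R = S/Q` is tightly closed (the crux's inline F-rational
  clause) and ONE parameter ideal of `R` has cyclic socle, then EVERY ideal of `R` is tightly closed.

References: M. Hochster, C. Huneke, Trans. AMS 346 (1994), Thm. 4.2; W. Bruns, J. Herzog,
*Cohen–Macaulay rings*, 1.2.19 and 3.2.10; H. Matsumura, *Commutative Ring Theory*, Thm. 18.1.
-/

-- single-problem summit: the doubled namespace component is forced
set_option linter.dupNamespace false

noncomputable section

namespace Summit.ResolutionOfSingularities.ResolutionOfSingularities.Theorems.FRationalResolution

/-- **F-RATIONAL + ONE IRREDUCIBLE PARAMETER IDEAL ⇒ WEAKLY F-REGULAR** (Hochster–Huneke 1994 for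
GORENSTEIN rings, in the tree's vocabulary "Cohen–Macaulay of type 1"; the Cohen–Macaulayness is
itself a consequence of F-rationality, Hochster–Huneke 1994 Thm. 4.2 (c), proved in the tree by
colon capturing, `isWeaklyRegular_of_fRational_clause_quotient`, c1). Let `S` be a regular local ring
of prime characteristic `p`, `Q` a prime ideal, `R = S/Q`. If every parameter ideal of `R` is tightly
closed (the crux's inline clause) and SOME parameter ideal `(Q₁)` (`dim R` elements of `𝔪_R`
generating an `𝔪_R`-primary ideal) has cyclic socle, then every ideal of `R` is tightly closed. -/
theorem weaklyFRegular_of_fRational_gorenstein (p : ℕ) [Fact p.Prime] (S : Type) [CommRing S]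
    [IsRegularLocalRing S] [CharP S p] (Q : Ideal S) [Q.IsPrime] [IsLocalRing (S ⧸ Q)]
    (hFR : ∀ d : ℕ, ringKrullDim (S ⧸ Q) = d → ∀ s : Fin d → S ⧸ Q,
      (Ideal.span (Set.range s)).radical.IsMaximal → ∀ y c : S ⧸ Q, c ≠ 0 →
      (∀ e : ℕ, c * y ^ p ^ e ∈ Ideal.span ((fun z : S ⧸ Q => z ^ p ^ e) ''
        (Ideal.span (Set.range s) : Set (S ⧸ Q)))) → y ∈ Ideal.span (Set.range s))
    (Q₁ : List (S ⧸ Q)) (h₁ : (Q₁.length : WithBot ℕ∞) = ringKrullDim (S ⧸ Q))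
    (hm₁ : ∀ q ∈ Q₁, q ∈ IsLocalRing.maximalIdeal (S ⧸ Q)) (N₁ : ℕ)
    (hN₁ : IsLocalRing.maximalIdeal (S ⧸ Q) ^ N₁ ≤ Ideal.ofList Q₁) (t₁ : S ⧸ Q)
    (hsoc : (Ideal.ofList Q₁).colon (IsLocalRing.maximalIdeal (S ⧸ Q) : Set (S ⧸ Q)) =
      Ideal.ofList Q₁ ⊔ Ideal.span {t₁})
    (I : Ideal (S ⧸ Q)) (y c : S ⧸ Q) (hc : c ≠ 0)
    (hy : ∀ e : ℕ, c * y ^ p ^ e ∈ Ideal.span ((fun z : S ⧸ Q => z ^ p ^ e) '' (I : Set (S ⧸ Q)))) :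
    y ∈ I := by
  -- F-rational ⇒ Cohen–Macaulay: every parameter LIST is a weakly regular sequence
  have hCM : ∀ L : List (S ⧸ Q), (L.length : WithBot ℕ∞) = ringKrullDim (S ⧸ Q) →
      (∀ q ∈ L, q ∈ IsLocalRing.maximalIdeal (S ⧸ Q)) →
      (∃ N : ℕ, IsLocalRing.maximalIdeal (S ⧸ Q) ^ N ≤ Ideal.ofList L) →
      RingTheory.Sequence.IsWeaklyRegular (S ⧸ Q) L := by
    intro L hL hLm ⟨N, hN⟩
    have hofFn : List.ofFn (fun i : Fin L.length => L.get i) = L := List.ofFn_get L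
    have hspan : Ideal.span (Set.range fun i : Fin L.length => L.get i) = Ideal.ofList L := by
      rw [Ideal.ofList, Set.range_list_get]
    have hrad : (Ideal.span (Set.range fun i : Fin L.length => L.get i)).radical.IsMaximal := by
      rw [hspan]
      have hle : Ideal.ofList L ≤ IsLocalRing.maximalIdeal (S ⧸ Q) :=
        Ideal.span_le.mpr fun q hq => hLm q hq
      have heq : (Ideal.ofList L).radical = IsLocalRing.maximalIdeal (S ⧸ Q) := by
        refine le_antisymm ?_ ?_
        · exact (Ideal.radical_mono hle).trans (Ideal.IsPrime.radical_le_iff inferInstance |>.mpr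
            le_rfl)
        · intro m hm
          exact ⟨N, hN (Ideal.pow_mem_pow hm N)⟩
      rw [heq]
      exact IsLocalRing.maximalIdeal.isMaximal _
    have h := isWeaklyRegular_of_fRational_clause_quotient p S Q hFR
      hL.symm (fun i : Fin L.length => L.get i) hrad
    rwa [hofFn] at h
  refine weaklyFRegular_of_fRational_of_socle_cyclic p (S ⧸ Q) hFR (fun d hd s hs => ?_) I y c hc hy
  -- the parameter ideal `(s)` as a list
  have hlen : ((List.ofFn s).length : WithBot ℕ∞) = ringKrullDim (S ⧸ Q) := by
    rw [List.length_ofFn, hd]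
  have hspan : Ideal.ofList (List.ofFn s) = Ideal.span (Set.range s) := by
    rw [Ideal.ofList]
    congr 1
    ext q
    simp [List.mem_ofFn']
  have hmax : (Ideal.span (Set.range s)).radical = IsLocalRing.maximalIdeal (S ⧸ Q) :=
    IsLocalRing.eq_maximalIdeal hs
  have hsm : ∀ q ∈ List.ofFn s, q ∈ IsLocalRing.maximalIdeal (S ⧸ Q) := by
    intro q hq
    rw [← hmax]
    exact Ideal.le_radical (hspan ▸ Ideal.subset_span hq)
  obtain ⟨N, hN⟩ : ∃ N : ℕ, IsLocalRing.maximalIdeal (S ⧸ Q) ^ N ≤ Ideal.ofList (List.ofFn s) := by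
    rw [hspan]
    refine Ideal.exists_pow_le_of_le_radical_of_fg (hmax ▸ le_rfl) (IsNoetherian.noetherian _)
  obtain ⟨t, ht⟩ := stub_socle_cyclic_of_one (S ⧸ Q) hCM Q₁ (List.ofFn s) h₁ hlen hm₁ hsm N₁ N
    hN₁ hN t₁ hsoc
  exact ⟨t, by rw [← hspan]; exact ht⟩

end Summit.ResolutionOfSingularities.ResolutionOfSingularities.Theorems.FRationalResolution

end
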